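import Summits.Langlands.Langlands.Theses.PhantomRMYoshida
import Literature.NumberTheory.Automorphic.SerreConjectureProofs
import Literature.NumberTheory.GaloisRepresentations.SerreWeightLowerBoundProofs
import Literature.NumberTheory.Automorphic.Taylor2006PotentialAutomorphy
import Literature.NumberTheory.Automorphic.ClozelAlgebraicity
import Literature.NumberTheory.Automorphic.AlgebraicityTwist

/-!
# Line `clozel-conjugation-alignment` — skeleton for crux `PhantomRMYoshida.SerreKWAutomorphicGL2`
# (stmt-Langlands-12944, route-Langlands-PhantomRMYoshida; crux-plan, round 1)

**Idea** (crux-idea card `clozel-conjugation-alignment`, ideator k = 1; triage r1: pass × 3).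
The crux is Serre's conjecture for `GL₂/ℚ` in the summit's automorphic L-normalisation: for every
`p`, every algebraically closed `k` of characteristic `p`, EVERY reduction map `red : 𝒪_{ℚ̄_p} → k`,
EVERY `ι : ℚ̄_p ≃ ℂ` and every odd irreducible `σ̄ : Γ_ℚ → GL₂(k)`, an L-algebraic cuspidal `π₂` on
`GL₂(𝔸_ℚ)` whose arithmetic-Frobenius Satake polynomials `∏ (X - ι⁻¹(a_j⁻¹))` are `p`-integral and
reduce through `red` to `charpoly σ̄(Frob_v)` a.e.  The in-tree Khare–Wintenberger fact
(`khare_wintenberger p k`, Galois side) produces a newform `f` and a HIDDEN residual coefficient map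
`ι_f : 𝓞_f → k`; the crux FIXES `(ι, red)` outside the existential.  The lever: the mismatch between
`ι_f` and `red ∘ ι⁻¹` is absorbed by ONE field automorphism `σ ∈ Aut(ℂ/ℚ)` with
`red ∘ ι⁻¹ ∘ σ = ι_f` on `𝓞_f` (pure commutative algebra: transitivity of `Gal(ℚ̄/ℚ)` on the primes of
`ℤ̄` over `p` + surjectivity of a decomposition group onto `Gal(𝔽̄_p/𝔽_p)`, `stub_autAlign`), and the
conjugation by `σ` is performed on the AUTOMORPHIC side — Clozel's algebraicity theorem (Thm. 3.13,
in tree as the named fact `Clozel1990_regularAlgebraic`, clause (ii)) read in Buzzard–Gee's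
L-normalisation on `GL₂/ℚ`: `σ` acts on the Satake parameters of a regular L-algebraic cuspidal `π`
(`stub_clozelConjugationL`; the `C`-normalised eigenvalues `t_{v,1} = √q·e₁` carry a `√q` that `σ`
may flip, the L-normalised `e_i(α)` do not — the twist `|det|^{±1/2}` there and back is inside the
stub).  No Galois-conjugate NEWFORM `f^σ` is ever needed (q-expansion rationality of `S_k(Γ₁(N))`
is not used); the automorphic realisation of `f` itself is the shared dictionary stub
`stub_newformDictionaryL` (newform of weight `k ≥ 2` ↦ cuspidal `π` with the weight-`k` L-algebraic
infinity type `weightInfinityTypeGL2 ℚ k` = `{(0,k-1),(k-1,0)}`, regular for `k ≠ 1`, and Satake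
parameter `{β₁⁻¹, β₂⁻¹}` at `q ∤ N`, `β_j` the roots of `X² - a_q X + ε(q) q^{k-1}`).

**Shape.** Four registered stubs and the kernel-checked composition
`SerreKWAutomorphicGL2_of : stub_khareWintenberger → stub_autAlign → stub_newformDictionaryL →
stub_clozelConjugationL → SerreKWAutomorphicGL2` (hypotheses as the named `Prop`s
`Registered.stub_*`, verbatim copies of the stub statements, certified equal by the `*_of_stub`
one-liners; wiring `example` at the end).  `sorry` occurs only inside the four `stub_*` theorems.

* `stub_khareWintenberger` — INPUT (XL in print, the in-tree named fact VERBATIM, universally over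
  `p, k`): Serre's conjecture, strong form (Khare–Wintenberger I Thm. 1.2 + 9.1, Kisin 2009).  The
  crux's content IS this theorem; every line consumes it once; it closes `proof.conditional` on the
  Literature fact `Literature.NumberTheory.Automorphic.khare_wintenberger` (no mathematics owed here).
  The STRONG form is used because the weight `k(σ̄) ≥ 2` (`two_le_serreWeightLocal_holds`, proved)
  is what makes the infinity type regular, hence Clozel applicable (weight one is exactly where
  `^σπ` is not available from Clozel — NonRegularWeight theme, met, see the line card).
* `stub_autAlign` — THE ALIGNMENT LEMMA (pure algebra, M/L): for `K ⊆ ℂ`, an integral `ℤ`-subalgebra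
  `A ⊆ K` and any ring map `φ : A → k`, there are `σ ∈ Aut(ℂ/ℚ)` and a ring map
  `θ : A → 𝒪_{ℚ̄_p}` with `θ = ι⁻¹ ∘ σ` on `A` and `red ∘ θ = φ` (the card's `exists_aut_align`,
  repackaged with the forced ring map `θ`; verified TRUE and elaborating by all three triagers).
* `stub_newformDictionaryL` — THE ADELIC DICTIONARY (L/XL, shared with the sibling lines
  `lowest-weight-casimir-dictionary` / `cyclic-bj-datum-adelic-newform` / `adelic-newform-datum-double-twist`,
  = their `NewformDictionaryL` at `k ≥ 2` in root form, with the infinity type made explicit):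
  Gelbart 1975 Prop. 3.1 / Thm. 5.19, Bump Thm. 3.6.1, in the tree's Borel–Jacquet vocabulary; the
  finite part is proved in tree (`NewformAdelisationHeckeOperator`, `hasSatakeParamAt_ofCuspForm_of_eigenvector`),
  the archimedean half (`φ_f ∈ 𝒜₀`, lowering operator kills `φ_f`, Casimir ⇒ HC parameter) is the gap.
* `stub_clozelConjugationL` — THE ENGINE (Clozel 1990 Thm. 3.13 = Patrikis arXiv:1207.6724
  Thm. 3.2.1, "the L-algebraic variant follows easily by twisting"; L given the in-tree fact):
  `Aut(ℂ/ℚ)` acts on regular L-algebraic cuspidal `π` of `GL₂(𝔸_ℚ)` through the Satake parameters,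
  preserving the infinity type.

**Disproof used.** `Disproof.lean` (cdisprove cycle 1) has NO `_false_without_` theorem and no
`-- Targets`; its load-bearing analysis (§2) is honoured: `IsOdd` and `IsIrreducible` are consumed
exactly once, at the KW step (`h₁ … hirr hodd`); §3 `red_factors_through_residue` is the first step of
the prover's proof of `stub_autAlign`; §4's convention-flip list (arithmetic Frobenius, half-twist
sign, nebentypus inversion, Galois-conjugate eigensystem) is exactly what the composition checks by
kernel: `arithFrobPolyOfSatake_one_rootsInv` (proved below) pins `m = 1` ↔ Satake `{β⁻¹}`, and the
`σ`-conjugate enters through `stub_clozelConjugationL`.  Negatives index (1 entry, K3 Kuga–Satake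
anchor): unrelated.  No landed `Theorems/SerreKWAutomorphicGL2/Negative/*` exists (2026-08-16).
-/

set_option linter.dupNamespace false

noncomputable section

open scoped MatrixGroups NumberField
open CongruenceSubgroup IsDedekindDomain Polynomial Filter Rat.HeightOneSpectrum
open Literature.NumberTheory.Automorphic Literature.NumberTheory.EllipticCurves.ModularForms
  Literature.NumberTheory.GaloisRepresentations
  Literature.NumberTheory.GaloisRepresentations.ModPGaloisRep
  Literature.NumberTheory.GaloisRepresentations.IsNonarchimedeanLocalField

namespace Summit.Langlands.Langlands.Cruxes.SerreKWAutomorphicGL2.ClozelConjugationAlignment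

/-! ## §1 The four registered stubs -/

/-- **STUB KW — `stub_khareWintenberger` (INPUT; XL in print; the in-tree named fact verbatim).**
Serre's modularity conjecture, strong form (3.2.4): for every prime `p` and every algebraically closed
field `k` of characteristic `p` (premises inside the `Prop`), every continuous irreducible odd
`σ̄ : Γ_ℚ → GL₂(k)` arises, for every local restriction datum `loc` at `p` and residue embedding `ι`,
from a newform `f ∈ S_{k(σ̄)}(Γ₁(N(σ̄)))` through some `ι_f : 𝓞_f →+* k`:
`charpoly σ̄(Frob_q) = ι_f(X² − a_q X + ε(q) q^{k(σ̄)−1})` for `q ∤ N(σ̄) p`.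
Why plausibly true: it is a THEOREM in print (Khare–Wintenberger, Invent. Math. 178 (2009), (I)
Thm. 1.2 + Thm. 9.1, with Kisin, ibid. 587–634, Thm. 0.1 / Cor. 0.2 = Hypothesis (H)); in the tree it
is the named fact `khare_wintenberger p k := SerreModularityConjecture p k`
(`Literature/NumberTheory/Automorphic/SerreConjecture.lean`), so this stub closes `proof.conditional`
on that fact by `fun p _ k _ _ _ => h p k` and owes no mathematics of its own.  It is NOT the crux in a
costume: Galois side, `∃ ι_f` inside, classical newform — the crux is automorphic, L-normalised, with
`∀ red ∀ ι` outside.  Size: XL (content) / XS (given the fact).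
Leans on: `khare_wintenberger`, `SerreModularityConjecture` (defs).
[cite: KhareWintenberger2009, Thm. 1.2 and Thm. 9.1] [cite: Kisin2009TwoAdic, Thm. 0.1, Cor. 0.2] -/
theorem stub_khareWintenberger :
    ∀ (p : ℕ) [Fact p.Prime] (k : Type) [Field k] [TopologicalSpace k] [DiscreteTopology k],
      khare_wintenberger p k := by
  sorry

/-- **STUB A — `stub_autAlign` (THE ALIGNMENT LEMMA; pure commutative algebra; M/L).**
For a prime `p`, an algebraically closed field `k` of characteristic `p`, a ring map
`red : 𝒪_{ℚ̄_p} → k` (necessarily reduction mod `𝔪` followed by an embedding `𝔽̄_p ↪ k`,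
Disproof §3 `red_factors_through_residue`), an isomorphism `ι : ℚ̄_p ≃ ℂ`, a subfield `K ⊆ ℂ`, a
`ℤ`-subalgebra `A ⊆ K` consisting of algebraic integers and ANY ring map `φ : A → k`: there is a field
automorphism `σ ∈ Aut(ℂ/ℚ)` such that `ι⁻¹ ∘ σ` maps `A` into `𝒪_{ℚ̄_p}` — as a ring map
`θ : A →+* 𝒪_{ℚ̄_p}` — with `red ∘ θ = φ`.
Why plausibly true (proof route, checked by the triage panel): `ker φ ∋ p` is a maximal ideal of `A`
(`A / ker φ ↪ k` is a domain integral over `𝔽_p`); extend `φ` to `φ̃ : ℤ̄ → k` (`ℤ̄ =` integral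
closure of `ℤ` in `ℚ̄ ⊂ ℂ`; lying-over `Ideal.exists_ideal_over_maximal_of_isIntegral` +
`IsAlgClosed.lift`); `ker φ̃ = 𝔐` and `ker (red ∘ ι⁻¹|ℤ̄) = 𝔐'` are maximal ideals of `ℤ̄` over `p`
(`ι⁻¹(ℤ̄) ⊆ 𝒪_{ℚ̄_p}`: algebraic integers have valuation `≤ 1`), so some `τ ∈ Gal(ℚ̄/ℚ)` has
`τ(𝔐) = 𝔐'` (Mathlib `Algebra.IsInvariant.exists_smul_of_under_eq_of_profinite`, used in tree at
`IntegralGaloisActionProofs`); the two resulting embeddings `ℤ̄/𝔐 ≅ 𝔽̄_p ↪ k` differ by an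
automorphism of `𝔽̄_p`, which lifts to the decomposition group
(`Ideal.Quotient.stabilizerHom_surjective_of_profinite`); finally extend `τ` from `ℚ̄` to `ℂ`
(Steinitz; in tree `DeligneSerre1974.exists_ringEquiv_comp_algebraMap_eq` /
`NumberField.nonempty_algebraicClosure_padic_ringEquiv_complex`-style lemmas, or restrict to the
Galois closure of `K` when `K` is a number field — triage r1-3 sharpening).  Degenerate checks:
`A = ℤ` (any `σ`; `θ = ι⁻¹`), `A = ℤ̄` (needs the full surjectivity onto `Gal(𝔽̄_p/𝔽_p)`),
`A = 𝓞_f` with `K_f = ℚ(√5)`, `p = 3` inert (the two maps differ on `a₂(23a)`: the lemma is not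
vacuous).  Equivalent to the card's `exists_aut_align` (`θ` is forced: `θ x = ⟨ι⁻¹(σ x), _⟩`).
Leans on: Mathlib `integralClosure`, `IsIntegral`, `PadicAlgCl`, `Valued.integer`,
`Algebra.IsInvariant.exists_smul_of_under_eq_of_profinite`, `Ideal.Quotient.stabilizerHom_surjective_of_profinite`,
`IsAlgClosed.lift`; tree `absIntegers`, `exists_isArithFrobAt_of_mem_primesAbove_holds`,
Disproof `red_factors_through_residue`. [cite: Serre1979LocalFields, Ch. I §7 Prop. 19–20 (transitivity, decomposition group)] -/
theorem stub_autAlign :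
    ∀ (p : ℕ) [Fact p.Prime] (k : Type) [Field k] [CharP k p] [IsAlgClosed k]
      (red : Valued.integer (PadicAlgCl p) →+* k) (ι : PadicAlgCl p ≃+* ℂ)
      (K : IntermediateField ℚ ℂ) (A : Subalgebra ℤ K), (∀ x ∈ A, IsIntegral ℤ x) →
      ∀ φ : A →+* k,
      ∃ (σ : ℂ ≃ₐ[ℚ] ℂ) (θ : A →+* Valued.integer (PadicAlgCl p)),
        (∀ x : A, ((θ x : Valued.integer (PadicAlgCl p)) : PadicAlgCl p) = ι.symm (σ ((x : K) : ℂ))) ∧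
        ∀ x : A, red (θ x) = φ x := by
  sorry

/-- **STUB D — `stub_newformDictionaryL` (THE ADELIC DICTIONARY in the L-normalisation; L/XL;
shared with the sibling lines).**  For a newform `f ∈ S_k(Γ₁(N))` of weight `k ≥ 2`
(`IsNewform1 f`) and the compactness datum `hcpt` there is a cuspidal automorphic representation
`π` of `GL₂(𝔸_ℚ)` (a Borel–Jacquet datum) with
(a) infinity type `weightInfinityTypeGL2 ℚ k = {(0, k-1), (k-1, 0)}` (L-algebraic for every `k`,
regular for `k ≠ 1`: `isLAlgebraic_/isRegular_weightInfinityTypeGL2`, proved), and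
(b) at every finite place `v` with `q_v ∤ N`, Satake parameter `{β₁⁻¹, β₂⁻¹}`, `β_j` the roots in `ℂ`
of the Hecke polynomial `X² − a_{q}(f) X + ε(q) q^{k−1}` (`heckePolynomial f q`, mapped to `ℂ`).
This is `π = π_f^{unit} ⊗ (ε⁻¹ ∘ det) ⊗ |det|^{(k−1)/2}`: the unitary datum GENERATED by the adelic lift
`φ_f = adelicLiftFunA N k f` (`CuspidalAutomorphicRepData.ofCuspForm`) has HC parameter
`{(k−1)/2, (1−k)/2}` and Satake pair `{α₁, α₂}`, `α₁ + α₂ = a_q q^{−(k−1)/2}`, `α₁α₂ = ε(q)`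
(`heckeOperator_principalCongruenceLevel_adelicLiftFunA_one/two` + `hasSatakeParamAt_ofCuspForm_of_eigenvector`,
PROVED); the twist by `ofDirichlet ε⁻¹` inverts the pair (`{α_j ε(q)⁻¹} = {α₂⁻¹, α₁⁻¹}`), the twist by
`|det|^{(k−1)/2}` multiplies it by `q^{−(k−1)/2}` (`HasSatakeParamAt.of_map_mulChar_detTwist_of_cpow`)
and shifts the HC parameter to `{k−1, 0}` (`exists_twist_hasInfinityType`), giving `{β_j⁻¹}` with
`β_j = q^{(k−1)/2} α_j` — the normalisation pin recomputed by hand by all three triagers and kernel-checked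
in `LeansOn.lean` (X₀(11), `q = 2`, `p = 3`).  GENUINELY MISSING in tree (the size of the stub):
`φ_f ∈ cuspFormsGL 2 ℚ hcpt` (archimedean smoothness, `K_∞`/`𝔷`-finiteness, growth, cusp condition
at function level) and "lowering operator kills `φ_f`" (Cauchy–Riemann via
`GL2Real.mdifferentiableAt_archDescent_iff_lowering`), then Casimir `⇒` HC parameter
(`GL2Casimir.hasHCParameter_of_lift_casimir_of_lift_zed`, central character by cyclicity /
`W_ofCuspForm_le`, no Schur).  Why plausibly true: Gelbart 1975 Prop. 3.1 + Thm. 5.19, Bump 1997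
Thm. 3.6.1 (theorems); `2 ≤ k` only because that is all this line needs (true for `k = 1` too).
Not a costume: it says nothing mod `p` and consumes no Galois representation.
Leans on: `CuspidalAutomorphicRepData.ofCuspForm`, `W_ofCuspForm_le`, `adelicLiftFunA`,
`Gelbart1975_exists_adelicNewform_holds`, `exists_twist_hasInfinityType`, `HeckeCharacter.ofDirichlet`,
`weightInfinityTypeGL2`, `heckePolynomial`, `IsNewform1`.
[cite: Gelbart1975, Prop. 3.1 and Thm. 5.19] [cite: Bump1997, Thm. 3.6.1] [cite: BuzzardGeeLMS2014, §3.1] -/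
theorem stub_newformDictionaryL :
    ∀ (N : ℕ) [NeZero N] (k : ℕ), 2 ≤ k → ∀ (f : CuspForm (Gamma1 N) (k : ℤ)), IsNewform1 f →
      ∀ (hcpt : isCompact_glFiniteIntegralLevel 2 ℚ),
      ∃ π : CuspidalAutomorphicRepData 2 ℚ hcpt,
        π.1.HasInfinityType (weightInfinityTypeGL2 ℚ k) ∧
        ∀ v : HeightOneSpectrum (𝓞 ℚ), ¬ ((primesEquiv v : Nat.Primes) : ℕ) ∣ N →
          π.1.HasSatakeParamAt v
            (((heckePolynomial f (primesEquiv v : Nat.Primes)).map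
              (algebraMap (coeffCharField f) ℂ)).roots.map (·⁻¹)) := by
  sorry

/-- **STUB C — `stub_clozelConjugationL` (THE ENGINE: Clozel's conjugation in the L-normalisation on
`GL₂/ℚ`; L given the in-tree fact, XL in print).**  Let `π` be a cuspidal automorphic representation
of `GL₂(𝔸_ℚ)` with a regular L-algebraic infinity type `T` (integral `a`-exponents, `a₁ ≠ a₂`).  Then
for every `σ ∈ Aut(ℂ/ℚ)` there is a cuspidal `π'` with the SAME infinity type `T` whose Satake
parameter at almost every finite place `v` is `σ` applied to that of `π`:
`π.Sat_v = α ⇒ π'.Sat_v = σ(α)` (as multisets).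
Why plausibly true (the card's lever, √q-trap included): `π₁ := π ⊗ |det|^{1/2}` is cuspidal with
infinity type `T.twist ½`, which is C-algebraic (`a + ½ ∈ ½ + ℤ = (n−1)/2 + ℤ`, `n = 2`) and regular
(`IsRegular.twist`), i.e. `IsRegularAlgebraic` (`CuspidalAutomorphicRepData.exists_twist_hasInfinityType`,
PROVED); its Satake parameter is `α q^{−1/2}` (`HasSatakeParamAt.of_map_mulChar_detTwist_of_cpow`,
PROVED), so its Hecke eigenvalues `t_{v,1} = √q e₁(α q^{−1/2}) = e₁(α)`, `t_{v,2} = e₂(α) q^{−1}` carry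
NO `√q`.  Clozel (ii) (`Clozel1990_regularAlgebraic.exists_autConjugate`, the in-tree named fact,
Thm. 3.13) gives a cuspidal `π₂` with `IsAutConjugate σ π₁ π₂`: `t_{v,i}(π₂) = σ(t_{v,i}(π₁))`, i.e.
`e₁(α₂) = σ(e₁ α)/√q`, `e₂(α₂) = σ(e₂ α)/q`, whence (card `= 2`, Vieta) `α₂ = σ(α)·q^{−1/2}`
(`hasSatakeParamAt_unique_holds`, PROVED, identifies the parameters), and an infinity type `T₂` with
the `a`-multisets of `(T.twist ½).autConj σ = T.twist ½` (`ℚ` has one complex embedding), C-algebraic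
again by well-formedness (`b`-multiset = `a`-multiset over `ℚ`).  Finally `π' := π₂ ⊗ |det|^{−1/2}`:
Satake `α₂ q^{1/2} = σ(α)`, archimedean parameter that of `T`, and `T` is well formed, so
`π'.HasInfinityType T`.  (In the C-normalisation `σ` would act on `√q e₁` and a quadratic character
`σ(√q)/√q` would appear — this is why the statement lives in the L-normalisation.)  Regularity is
essential: for weight one (`T = {(0,0),(0,0)}`) Clozel's theorem is unavailable and the statement,
though true (Deligne–Serre), is not claimed here.  Size: M/L of Lean on top of the named fact.
Leans on: `Clozel1990_regularAlgebraic` (NAMED FACT, unproved, XL), `IsAutConjugate`, `heckeEigenvalueOf`,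
`InfinityType.autConj_apply`, `CuspidalAutomorphicRepData.exists_twist_hasInfinityType`,
`AutomorphicRepData.HasSatakeParamAt.of_map_mulChar_detTwist_of_cpow`,
`hasSatakeParamAt_iff_of_map_mulChar_detTwist_of_cpow`, `hasSatakeParamAt_unique_holds`,
`HasSatakeParamAt.card_eq`, `InfinityType.IsRegular.twist`, `isCAlgebraic_iff_isLAlgebraic_twist`.
[cite: Clozel1990, Thm. 3.13] [cite: Patrikis2019, Thm. 3.2.1 (arXiv:1207.6724 §3.2: "the L-algebraic variant follows easily by twisting")] [cite: BuzzardGeeLMS2014, §3.1, §5.3] -/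
theorem stub_clozelConjugationL :
    ∀ (hcpt : isCompact_glFiniteIntegralLevel 2 ℚ) (π : CuspidalAutomorphicRepData 2 ℚ hcpt)
      (T : InfinityType ℚ 2), π.1.HasInfinityType T → T.IsLAlgebraic → T.IsRegular →
      ∀ σ : ℂ ≃ₐ[ℚ] ℂ, ∃ π' : CuspidalAutomorphicRepData 2 ℚ hcpt,
        π'.1.HasInfinityType T ∧
        ∀ᶠ v : HeightOneSpectrum (𝓞 ℚ) in Filter.cofinite, ∀ α : Multiset ℂ,
          π.1.HasSatakeParamAt v α → π'.1.HasSatakeParamAt v (α.map σ) := by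
  sorry

/-! ## §2 The stub statements as named `Prop`s (verbatim copies; `*_of_stub` certify equality) -/

/-- Statement of `stub_khareWintenberger`, by name. -/
def KhareWintenbergerAll : Prop :=
  ∀ (p : ℕ) [Fact p.Prime] (k : Type) [Field k] [TopologicalSpace k] [DiscreteTopology k],
    khare_wintenberger p k

/-- Statement of `stub_autAlign`, by name. -/
def AutAlign : Prop :=
  ∀ (p : ℕ) [Fact p.Prime] (k : Type) [Field k] [CharP k p] [IsAlgClosed k]
    (red : Valued.integer (PadicAlgCl p) →+* k) (ι : PadicAlgCl p ≃+* ℂ)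
    (K : IntermediateField ℚ ℂ) (A : Subalgebra ℤ K), (∀ x ∈ A, IsIntegral ℤ x) →
    ∀ φ : A →+* k,
    ∃ (σ : ℂ ≃ₐ[ℚ] ℂ) (θ : A →+* Valued.integer (PadicAlgCl p)),
      (∀ x : A, ((θ x : Valued.integer (PadicAlgCl p)) : PadicAlgCl p) = ι.symm (σ ((x : K) : ℂ))) ∧
      ∀ x : A, red (θ x) = φ x

/-- Statement of `stub_newformDictionaryL`, by name. -/
def NewformDictionaryL : Prop :=
  ∀ (N : ℕ) [NeZero N] (k : ℕ), 2 ≤ k → ∀ (f : CuspForm (Gamma1 N) (k : ℤ)), IsNewform1 f →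
    ∀ (hcpt : isCompact_glFiniteIntegralLevel 2 ℚ),
    ∃ π : CuspidalAutomorphicRepData 2 ℚ hcpt,
      π.1.HasInfinityType (weightInfinityTypeGL2 ℚ k) ∧
      ∀ v : HeightOneSpectrum (𝓞 ℚ), ¬ ((primesEquiv v : Nat.Primes) : ℕ) ∣ N →
        π.1.HasSatakeParamAt v
          (((heckePolynomial f (primesEquiv v : Nat.Primes)).map
            (algebraMap (coeffCharField f) ℂ)).roots.map (·⁻¹))

/-- Statement of `stub_clozelConjugationL`, by name. -/
def ClozelConjugationL : Prop :=
  ∀ (hcpt : isCompact_glFiniteIntegralLevel 2 ℚ) (π : CuspidalAutomorphicRepData 2 ℚ hcpt)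
    (T : InfinityType ℚ 2), π.1.HasInfinityType T → T.IsLAlgebraic → T.IsRegular →
    ∀ σ : ℂ ≃ₐ[ℚ] ℂ, ∃ π' : CuspidalAutomorphicRepData 2 ℚ hcpt,
      π'.1.HasInfinityType T ∧
      ∀ᶠ v : HeightOneSpectrum (𝓞 ℚ) in Filter.cofinite, ∀ α : Multiset ℂ,
        π.1.HasSatakeParamAt v α → π'.1.HasSatakeParamAt v (α.map σ)

theorem khareWintenbergerAll_of_stub : KhareWintenbergerAll := stub_khareWintenberger
theorem autAlign_of_stub : AutAlign := stub_autAlign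
theorem newformDictionaryL_of_stub : NewformDictionaryL := stub_newformDictionaryL
theorem clozelConjugationL_of_stub : ClozelConjugationL := stub_clozelConjugationL

/-! The registered obligations of this line, by the names the skeleton audit admits as hypotheses
(last name component = the stub's name). -/
namespace Registered

/-- = `stub_khareWintenberger`. -/
abbrev stub_khareWintenberger : Prop := KhareWintenbergerAll
/-- = `stub_autAlign`. -/
abbrev stub_autAlign : Prop := AutAlign
/-- = `stub_newformDictionaryL`. -/
abbrev stub_newformDictionaryL : Prop := NewformDictionaryL
/-- = `stub_clozelConjugationL`. -/
abbrev stub_clozelConjugationL : Prop := ClozelConjugationL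

end Registered

/-! ## §3 Proved glue lemmas -/

/-- The finite places of `ℚ` whose prime divides `M ≠ 0` form a finite set (`v ↦ p_v` is injective,
`Rat.HeightOneSpectrum.primesEquiv`). [folklore] -/
theorem finite_setOf_primesEquiv_dvd {M : ℕ} (hM : M ≠ 0) :
    {v : HeightOneSpectrum (𝓞 ℚ) | ((primesEquiv v : Nat.Primes) : ℕ) ∣ M}.Finite := by
  have hfin : (Set.Iic M).Finite := Set.finite_Iic M
  refine (hfin.preimage (f := fun v : HeightOneSpectrum (𝓞 ℚ) ↦ ((primesEquiv v : Nat.Primes) : ℕ))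
    ?_).subset ?_
  · intro v _ w _ hvw
    exact primesEquiv.injective (Subtype.ext hvw)
  · intro v hv
    exact Nat.le_of_dvd (Nat.pos_of_ne_zero hM) hv

/-- Almost every finite place of `ℚ` is prime to `M ≠ 0`. [folklore] -/
theorem eventually_not_dvd {M : ℕ} (hM : M ≠ 0) :
    ∀ᶠ v : HeightOneSpectrum (𝓞 ℚ) in Filter.cofinite, ¬ ((primesEquiv v : Nat.Primes) : ℕ) ∣ M := by
  rw [Filter.eventually_cofinite]
  simpa only [not_not] using finite_setOf_primesEquiv_dvd hM

/-- **The Buzzard–Gee polynomial of the Satake parameter `{β⁻¹ : β}` is `∏_β (X - ι⁻¹ β)`**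
(`m = 1`, L-normalisation): for a monic `G ∈ ℂ[X]` (which splits) with roots `β`,
`arithFrobPolyOfSatake ι q 1 (G.roots.map (·⁻¹)) = G.map ι⁻¹`, since `(β⁻¹)⁻¹ = β`.  The `m = 1` twin
of the tree's `arithFrobPolyOfSatake_heckeRoots` (`m = 2`, parameters `(√q β)⁻¹`); pins the
half-twist: the crux's polynomial is matched by the Satake parameter `{β_j⁻¹}` and by nothing else.
[cite: BuzzardGeeLMS2014, §2.1 and Conj. 3.2.1] -/
theorem arithFrobPolyOfSatake_one_rootsInv {ℓ : ℕ} [Fact ℓ.Prime] (ι : PadicAlgCl ℓ ≃+* ℂ)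
    (q : ℕ) {G : ℂ[X]} (hG : G.Monic) :
    arithFrobPolyOfSatake ι q 1 (G.roots.map (·⁻¹)) = G.map (ι.symm : ℂ →+* PadicAlgCl ℓ) := by
  rw [arithFrobPolyOfSatake_one, Multiset.map_map]
  have hcard : Multiset.card G.roots = G.natDegree :=
    Polynomial.splits_iff_card_roots.mp (IsAlgClosed.splits G)
  trans (G.roots.map fun β ↦ (X - C β).map (ι.symm : ℂ →+* PadicAlgCl ℓ)).prod
  · congr 1
    refine Multiset.map_congr rfl fun β _ ↦ ?_
    simp only [Function.comp_apply, inv_inv, Polynomial.map_sub, Polynomial.map_X, Polynomial.map_C]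
    rfl
  · conv_rhs => rw [← Polynomial.prod_multiset_X_sub_C_of_monic_of_roots_card_eq hG hcard]
    rw [Polynomial.map_multiset_prod, Multiset.map_map]
    rfl

/-- `σ` applied to the inverted roots of a complex polynomial `H` = the inverted roots of `σ(H)`
(`ℂ` algebraically closed, `σ` a field automorphism). [folklore] -/
theorem map_aut_rootsInv (σ : ℂ ≃ₐ[ℚ] ℂ) (H : ℂ[X]) :
    (H.roots.map (·⁻¹)).map σ = ((H.map (σ : ℂ →+* ℂ)).roots).map (·⁻¹) := by
  rw [(IsAlgClosed.splits H).roots_map (σ : ℂ →+* ℂ), Multiset.map_map, Multiset.map_map]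
  refine Multiset.map_congr rfl fun x _ ↦ ?_
  simp only [Function.comp_apply, map_inv₀, RingHom.coe_coe]

/-! ## §4 The composition: the four stubs imply the crux, by name -/

/-- **The line concludes the crux.**
`stub_khareWintenberger → stub_autAlign → stub_newformDictionaryL → stub_clozelConjugationL →
SerreKWAutomorphicGL2`, kernel-checked; the only `sorry`s of the file are inside the four stubs.
Proof: fix `p, k, red, σ̄, hcpt, ι`; KW (strong form, at an inhabited local datum `loc` and residue
embedding — `nonempty_localRestrictionAt`, `nonempty_ringHom_residue`, PROVED) gives a newform `f` of
level `N(σ̄)` and weight `w = k(σ̄) ≥ 2` (`two_le_serreWeightLocal_holds`, PROVED) with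
`ι_f : 𝓞_f → k` and `charpoly σ̄(Frob_v) = ι_f(P₀)`, `P₀ ↦ X² − a_q X + ε(q)q^{w−1}`, for `q ∤ N p`;
`stub_autAlign` at `A = 𝓞_f`, `φ = ι_f` gives `σ ∈ Aut(ℂ/ℚ)` and `θ = ι⁻¹σ| : 𝓞_f → 𝒪_{ℚ̄_p}` with
`red ∘ θ = ι_f`; the dictionary gives `π` (weight-`w` infinity type, Satake `{β⁻¹}` at `q ∤ N`);
Clozel gives `π'` with the same (L-algebraic) infinity type and Satake `σ{β⁻¹} = {γ⁻¹}`, `γ` the roots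
of `σ(H)`; at the cofinitely many `v` with `q_v ∤ N p` inside Clozel's a.e. set take `a = {γ_j⁻¹}`,
`P = θ(P₀)`, `P̄ = ι_f(P₀)`: `P.map subtype = (σH).map ι⁻¹ = arithFrobPolyOfSatake ι q 1 a`
(`arithFrobPolyOfSatake_one_rootsInv`) and `P.map red = ι_f(P₀) = P̄`. -/
theorem SerreKWAutomorphicGL2_of (h₁ : Registered.stub_khareWintenberger)
    (h₂ : Registered.stub_autAlign) (h₃ : Registered.stub_newformDictionaryL)
    (h₄ : Registered.stub_clozelConjugationL) :
    Summit.Langlands.Langlands.Theses.PhantomRMYoshida.SerreKWAutomorphicGL2 := by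
  intro p _ k _ _ _ _ _ red ρ hodd hirr hcpt ι
  -- Step 1: Khare–Wintenberger (strong form) at an inhabited local datum; weight ≥ 2
  obtain ⟨loc⟩ := nonempty_localRestrictionAt p ρ
  obtain ⟨ιres⟩ := nonempty_ringHom_residue (k := k) p loc.F loc.residueFieldCard_eq
  haveI : NeZero (serreLevel p ρ) := ⟨fun h => not_dvd_serreLevel p ρ (h ▸ dvd_zero p)⟩
  have hw : 2 ≤ serreWeight p ρ loc ιres :=
    ModPGaloisRep.two_le_serreWeightLocal_holds loc.rep ιres
  obtain ⟨f, ιf, hnew, hρf⟩ := h₁ p k ρ hirr hodd loc ιres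
  -- Step 2: the alignment automorphism `σ` and `θ = ι⁻¹ ∘ σ : 𝓞_f → 𝒪_{ℚ̄_p}` with `red ∘ θ = ι_f`
  obtain ⟨σ, θ, hθ, hred⟩ := h₂ p k red ι (coeffCharField f) (coeffCharIntegers f)
    (fun x hx => (mem_integralClosure_iff ℤ _).mp hx) ιf
  -- Step 3: the automorphic realisation of `f` (weight-`w` infinity type, Satake `{β⁻¹}`)
  obtain ⟨π, hπT, hπSat⟩ := h₃ (serreLevel p ρ) (serreWeight p ρ loc ιres) hw f hnew hcpt
  -- Step 4: Clozel's `σ`-conjugate in the L-normalisation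
  have hk1 : serreWeight p ρ loc ιres ≠ 1 := by omega
  obtain ⟨π', hπ'T, hconj⟩ := h₄ hcpt π _ hπT (isLAlgebraic_weightInfinityTypeGL2 _)
    (isRegular_weightInfinityTypeGL2 hk1) σ
  refine ⟨π', ⟨_, hπ'T, isLAlgebraic_weightInfinityTypeGL2 _⟩, ?_⟩
  -- Step 5: almost every place is prime to `N p` and inside Clozel's a.e. set
  have hM : serreLevel p ρ * p ≠ 0 := mul_ne_zero (NeZero.ne _) (Fact.out : p.Prime).ne_zero
  filter_upwards [hconj, eventually_not_dvd hM] with v hv4 hvS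
  have hvN : ¬ ((primesEquiv v : Nat.Primes) : ℕ) ∣ serreLevel p ρ :=
    fun h => hvS (dvd_mul_of_dvd_left h p)
  obtain ⟨hunr, P₀, hP₀, hFrob⟩ := hρf v hvS
  have hSat := hv4 _ (hπSat v hvN)
  -- the data of the crux at `v`
  refine ⟨_, P₀.map θ, P₀.map ιf, hSat, ?_, hunr, hFrob, ?_⟩
  · -- `P.map subtype = arithFrobPolyOfSatake ι q 1 (σ{β⁻¹})`
    set H : ℂ[X] := (heckePolynomial f (primesEquiv v : Nat.Primes)).map
      (algebraMap (coeffCharField f) ℂ) with hHdef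
    have hHmonic : H.Monic := (monic_heckePolynomial f _).map _
    have hGmonic : (H.map (σ : ℂ →+* ℂ)).Monic := hHmonic.map _
    rw [map_aut_rootsInv σ H, arithFrobPolyOfSatake_one_rootsInv ι _ hGmonic, hHdef, ← hP₀,
      Polynomial.map_map, Polynomial.map_map, Polynomial.map_map, Polynomial.map_map]
    congr 1
    refine RingHom.ext fun x => ?_
    simp only [RingHom.comp_apply, RingHom.coe_coe]
    exact hθ x
  · -- `P.map red = ι_f(P₀)`
    rw [Polynomial.map_map]
    congr 1
    exact RingHom.ext hred

/-- Wiring check: the registered stubs feed `SerreKWAutomorphicGL2_of` as stated. -/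
example : Summit.Langlands.Langlands.Theses.PhantomRMYoshida.SerreKWAutomorphicGL2 :=
  SerreKWAutomorphicGL2_of stub_khareWintenberger stub_autAlign stub_newformDictionaryL
    stub_clozelConjugationL

end Summit.Langlands.Langlands.Cruxes.SerreKWAutomorphicGL2.ClozelConjugationAlignment

end
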